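import Literature.Analysis.UnboundedOperators.SpectralGap
import HarnessLib

/-!
# Proofs for the spectral gap (companion of `SpectralGap.lean`)

Trunk: UnbddOp (prelude item C2 `SpectralGap`). Discharges of named facts stated in
`Literature/Analysis/UnboundedOperators/SpectralGap.lean`. First, two facts about the numerical spectral gap
`T.spectralGap = sInf (re '' σ(T) ∖ {E₀}) - E₀`, `E₀ = T.groundEnergy = sInf (re '' σ(T))`, of a
bounded self-adjoint operator `T` with `T.HasSpectralGap Δ`
(`re '' σ(T) ⊆ {E₀} ∪ [E₀ + Δ, ∞)`, `0 < Δ`, `E₀` a simple eigenvalue):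

* `ContinuousLinearMap.le_spectralGap_of_hasSpectralGap_holds` — `Δ ≤ T.spectralGap`;
* `ContinuousLinearMap.HasSpectralGap.spectralGap_pos_holds` — `0 < T.spectralGap`;

both under the guard that `re '' σ(T) ∖ {E₀}` is nonempty (otherwise `spectralGap` is the
documented junk value `-E₀`).

Both are pure order theory on the definitions: removing `{E₀}` from
`re '' σ(T) ⊆ {E₀} ∪ [E₀ + Δ, ∞)` leaves a nonempty subset of `[E₀ + Δ, ∞)`, whose infimum in the
conditionally complete lattice `ℝ` is therefore `≥ E₀ + Δ` (`le_csInf`); subtracting `E₀` gives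
`Δ ≤ T.spectralGap`, and `0 < Δ` finishes. The framing — ground energy `E₀ = inf σ(H)` and the
gap as the distance from `E₀` to the rest of the spectrum — is that of Reed–Simon,
*Methods of Modern Mathematical Physics IV*, §XIII.1 (bib key `ReedSimonIV1978`), as cited by the
definitions in `SpectralGap.lean`; the two inequalities themselves are definitional [folklore].

Mathlib anchors: `le_csInf`, `linarith`.

Second, the form-level simplicity of the ground state,
`LinearPMap.HasFormGap.kernel_eq_span_holds`: under `A.HasFormGap Ω Δ` (positivity, `Ω ≠ 0`,
`A Ω = 0`, `0 < Δ`, `Δ ‖x‖² ≤ re ⟪x, A x⟫` on `dom A ∩ {Ω}ᗮ`) the kernel of `A` is the line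
`𝕜 ∙ Ω`. This is the quadratic-form content of "the ground state is non-degenerate"
(Reed–Simon IV, §XIII.12; Glimm–Jaffe, *Quantum Physics*, §6.1): for `x ∈ ker A` write
`x = c Ω + y` with `c = ⟪Ω, x⟫ / ⟪Ω, Ω⟫` and `y ⊥ Ω`; then `y ∈ dom A`, `A y = 0`, and the gap
inequality `Δ ‖y‖² ≤ re ⟪y, A y⟫ = 0` forces `y = 0`. No completeness of `E` is needed.
Mathlib anchors: `Submodule.mem_orthogonal_singleton_iff_inner_right`, `inner_self_eq_zero`,
`LinearPMap.map_sub`, `LinearPMap.map_smul`, `Submodule.mem_span_singleton`.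

Third, the finite-dimensional sanity check
`LinearMap.IsSymmetric.hasSpectralGap_toContinuousLinearMap_iff_holds`: for a symmetric `T` on a
space of dimension `n + 2`, `toContinuousLinearMap T` has the spectral gap `Δ` iff `0 < Δ` and
(lowest eigenvalue) `+ Δ ≤` (second lowest eigenvalue) — the finite-dimensional case of the
min–max principle (Reed–Simon IV, §XIII.1, pp. 75–78, Theorem XIII.1), here read off Mathlib's
spectral theorem for symmetric operators (`LinearMap.IsSymmetric.eigenvalues`, sorted
decreasingly). See the section docstring below for the architecture.

Fourth, the bridge between the unbounded and the bounded formulation,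
`ContinuousLinearMap.hasGroundStateGap_toPMap_iff_holds` (Reed–Simon IV, Theorem XIII.1, the
min–max principle, specialised to a bounded self-adjoint `T` with ground energy `0` and ground
state `Ω`): `T.toPMap ⊤` has the ground-state gap `Δ` at `Ω` iff `T.HasSpectralGap Δ`. The
printed proof of Theorem XIII.1 goes through the spectral measure; Mathlib has no spectral theorem
for bounded self-adjoint operators over `RCLike 𝕜`, so the file develops the elementary
numerical-range/resolvent substitute (all proved inline, uniformly in `𝕜 = ℝ, ℂ`):
Cauchy–Schwarz for the form of a positive operator (`IsPositive.norm_inner_sq_le`, borrowed from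
Mathlib's `PreInnerProductSpace.Core`), "positive and invertible ⇒ coercive"
(`IsPositive.exists_pos_le_re_inner_of_isUnit`), "resolvent set below `a` ⇒ `S ≥ a`" by
continuous induction (`re_inner_ge_of_forall_lt_isUnit`, Mathlib's
`IsClosed.mem_of_ge_of_forall_exists_gt`), the resolvent form bound across a gap
(`re_inner_shift_le_of_gap`, the norm-free form of `‖(T - c)⁻¹‖ = dist(c, σ(T))⁻¹`), and the gap
inequality on `range T` (`gap_le_re_inner_on_range`). Mathlib anchors:
`ContinuousLinearMap.isUnit_of_forall_le_norm_inner_map`,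
`ContinuousLinearMap.bijective_iff_dense_range_and_antilipschitz`,
`ContinuousLinearMap.orthogonal_ker`/`orthogonal_range`,
`ContinuousLinearMap.toPMap_adjoint_eq_adjoint_toPMap_of_dense`, `spectrum.mem_iff`.
-/

noncomputable section

open RCLike

variable {𝕜 E : Type*} [RCLike 𝕜] [NormedAddCommGroup E] [InnerProductSpace 𝕜 E]

namespace ContinuousLinearMap

variable [CompleteSpace E]

/-- Discharge of `ContinuousLinearMap.le_spectralGap_of_hasSpectralGap`: if `T.HasSpectralGap Δ`
and `S := re '' σ(T) ∖ {E₀}` (`E₀ = T.groundEnergy`) is nonempty, then `Δ ≤ T.spectralGap`.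
Proof: the last conjunct of `HasSpectralGap` gives `re '' σ(T) ⊆ {E₀} ∪ [E₀ + Δ, ∞)`, hence
`S ⊆ [E₀ + Δ, ∞)`; as `S` is nonempty, `E₀ + Δ ≤ sInf S` (`le_csInf`), i.e.
`Δ ≤ sInf S - E₀ = T.spectralGap`. Framing: Reed–Simon IV, §XIII.1; the inequality is
definitional. [folklore] -/
theorem le_spectralGap_of_hasSpectralGap_holds :
    le_spectralGap_of_hasSpectralGap (𝕜 := 𝕜) (E := E) := by
  intro T Δ h hne
  obtain ⟨-, -, -, hsub⟩ := h
  have hle : T.groundEnergy + Δ ≤ sInf ((re '' spectrum 𝕜 T) \ {T.groundEnergy}) := by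
    refine le_csInf hne ?_
    rintro x ⟨hx, hxE₀⟩
    rcases hsub hx with h₀ | h₁
    · exact absurd h₀ hxE₀
    · exact h₁
  unfold spectralGap
  linarith

/-- Discharge of `ContinuousLinearMap.HasSpectralGap.spectralGap_pos`: under `T.HasSpectralGap Δ`,
if `re '' σ(T) ∖ {T.groundEnergy}` is nonempty then `0 < T.spectralGap`. Proof: `0 < Δ` (second
conjunct of `HasSpectralGap`) and `Δ ≤ T.spectralGap`
(`le_spectralGap_of_hasSpectralGap_holds`); this is the interim proof preserved as a comment in
`SpectralGap.lean`, now fed the discharged fact. Framing: Reed–Simon IV, §XIII.1. [folklore] -/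
theorem HasSpectralGap.spectralGap_pos_holds :
    HasSpectralGap.spectralGap_pos (𝕜 := 𝕜) (E := E) :=
  fun h hne => h.2.1.trans_le (le_spectralGap_of_hasSpectralGap_holds h hne)

end ContinuousLinearMap

/-! ### Simplicity of the ground state under a form gap -/

namespace LinearPMap

/-- **Discharge** of the named fact `LinearPMap.HasFormGap.kernel_eq_span`: under a form gap
`A.HasFormGap Ω Δ` the kernel of `A` is exactly the line spanned by the ground state,
`ker A = 𝕜 ∙ Ω` (the ground state is simple; Reed–Simon IV, §XIII.12, non-degenerate ground
states; Glimm–Jaffe, *Quantum Physics*, §6.1). Proof: `𝕜 ∙ Ω ≤ ker A` because `Ω ∈ dom A` and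
`A Ω = 0`. Conversely, for `x ∈ ker A` put `c := ⟪Ω, x⟫ / ⟪Ω, Ω⟫` and `y := x - c • Ω`; then
`⟪Ω, y⟫ = 0`, `y ∈ dom A` with `A y = A x - c • A Ω = 0`, so the gap inequality on
`dom A ∩ {Ω}ᗮ` reads `Δ ‖y‖² ≤ re ⟪y, A y⟫ = 0`; as `0 < Δ` this forces `y = 0`, i.e.
`x = c • Ω ∈ 𝕜 ∙ Ω`. Elementary linear algebra on the definitions; no completeness of `E` is
used. [folklore] -/
theorem HasFormGap.kernel_eq_span_holds : HasFormGap.kernel_eq_span (𝕜 := 𝕜) (E := E) := by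
  intro A Ω Δ h
  obtain ⟨-, hΩ0, ⟨hΩd, hAΩ⟩, hΔ, hbd⟩ := h
  refine le_antisymm ?_ ?_
  · intro x hx
    obtain ⟨hxd, hAx⟩ := mem_kernel_iff.mp hx
    -- the component of `x` orthogonal to `Ω`
    set c : 𝕜 := inner 𝕜 Ω x / inner 𝕜 Ω Ω with hc
    have hΩΩ : inner 𝕜 Ω Ω ≠ 0 := inner_self_ne_zero.mpr hΩ0
    have hyd : x - c • Ω ∈ A.domain := A.domain.sub_mem hxd (A.domain.smul_mem c hΩd)
    have hy_orth : x - c • Ω ∈ (𝕜 ∙ Ω)ᗮ := by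
      rw [Submodule.mem_orthogonal_singleton_iff_inner_right, inner_sub_right, inner_smul_right,
        hc, div_mul_cancel₀ _ hΩΩ, sub_self]
    have hAy : A ⟨x - c • Ω, hyd⟩ = 0 := by
      have hrepr : (⟨x - c • Ω, hyd⟩ : A.domain) = ⟨x, hxd⟩ - c • ⟨Ω, hΩd⟩ := rfl
      rw [hrepr, LinearPMap.map_sub, LinearPMap.map_smul, hAx, hAΩ, smul_zero, sub_zero]
    -- the gap inequality kills the orthogonal component
    have hgap := hbd ⟨x - c • Ω, hyd⟩ hy_orth
    rw [hAy, inner_zero_right, RCLike.zero_re] at hgap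
    have hnorm : ‖x - c • Ω‖ ^ 2 = 0 :=
      le_antisymm (nonpos_of_mul_nonpos_right hgap hΔ) (sq_nonneg _)
    have hy0 : x - c • Ω = 0 :=
      norm_eq_zero.mp ((pow_eq_zero_iff two_ne_zero).mp hnorm)
    rw [sub_eq_zero] at hy0
    rw [hy0]
    exact Submodule.smul_mem _ c (Submodule.mem_span_singleton_self Ω)
  · rw [Submodule.span_le, Set.singleton_subset_iff]
    exact mem_kernel_iff.mpr ⟨hΩd, hAΩ⟩

end LinearPMap

/-! ### The finite-dimensional sanity check

`LinearMap.IsSymmetric.hasSpectralGap_toContinuousLinearMap_iff_holds` discharges the named fact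
`LinearMap.IsSymmetric.hasSpectralGap_toContinuousLinearMap_iff`. The published argument is the
finite-dimensional case of the min–max principle (Reed–Simon IV, §XIII.1: the `3 × 3` motivating
example, pp. 75–76, and Theorem XIII.1, pp. 76–78): expand in an orthonormal eigenbasis, so that
`σ(T)` is the list of eigenvalues `λ₁ ≤ λ₂ ≤ ⋯` counted with multiplicity, the ground energy is
`λ₁ = min (ψ, Tψ)/(ψ, ψ)`, and "`λ₁` is simple and `σ(T) ∖ {λ₁} ⊆ [λ₁ + Δ, ∞)`" reads
`λ₁ + Δ ≤ λ₂`. In Lean the eigenbasis expansion is Mathlib's spectral theorem for symmetric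
operators: `LinearMap.IsSymmetric.eigenvalues` (sorted *decreasingly*,
`LinearMap.IsSymmetric.eigenvalues_antitone`, so `λ₁` is the entry `Fin.last (n + 1)` and `λ₂`
the entry `Fin.castSucc (Fin.last n)`), `LinearMap.IsSymmetric.card_filter_eigenvalues_eq`
(multiplicity = dimension of the eigenspace) and `LinearMap.IsSymmetric.exists_eigenvalues_eq`
(every eigenvalue is listed); `spectrum 𝕜 (toContinuousLinearMap T) = spectrum 𝕜 T` is
`AlgEquiv.spectrum_eq` for the algebra equivalence `Module.End.toContinuousLinearMap`, and in
finite dimension the spectrum is the set of eigenvalues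
(`Module.End.hasEigenvalue_iff_mem_spectrum`). -/

namespace LinearMap.IsSymmetric

section FiniteDimensional

variable [FiniteDimensional 𝕜 E]

/-- In `Fin (n + 2)`, every index other than the last one is at most the second-to-last one.
[folklore] -/
private lemma le_castSucc_last_of_ne_last {n : ℕ} {i : Fin (n + 2)}
    (hi : i ≠ Fin.last (n + 1)) : i ≤ Fin.castSucc (Fin.last n) := by
  have h := Fin.val_lt_last hi
  rw [Fin.le_def, Fin.val_castSucc, Fin.val_last]
  omega

/-- For an antitone real tuple on `Fin (n + 2)`, the last value has multiplicity one iff it is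
strictly below the second-to-last value. [folklore] -/
private lemma card_filter_eq_last_eq_one_iff {n : ℕ} {f : Fin (n + 2) → ℝ} (hf : Antitone f) :
    Finset.card {i | f i = f (Fin.last (n + 1))} = 1 ↔
      f (Fin.last (n + 1)) < f (Fin.castSucc (Fin.last n)) := by
  constructor
  · intro h
    refine lt_of_le_of_ne (hf (Fin.castSucc_lt_last _).le) fun heq => ?_
    have : 1 < Finset.card {i | f i = f (Fin.last (n + 1))} :=
      Finset.one_lt_card.mpr ⟨Fin.last (n + 1), by simp, Fin.castSucc (Fin.last n), by simp [heq],
        (Fin.castSucc_lt_last _).ne'⟩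
    omega
  · intro hlt
    rw [Finset.card_eq_one]
    refine ⟨Fin.last (n + 1), Finset.eq_singleton_iff_unique_mem.mpr ⟨by simp, fun i hi => ?_⟩⟩
    by_contra hne
    have h1 : f (Fin.castSucc (Fin.last n)) ≤ f i := hf (le_castSucc_last_of_ne_last hne)
    simp only [Finset.mem_filter, Finset.mem_univ, true_and] at hi
    linarith

/-- (Dot-notation extension of Mathlib's `LinearMap.IsSymmetric`.) For a symmetric operator `T`
on a finite-dimensional inner product space, the real parts of the spectrum of `T` viewed as a
continuous linear map are exactly the values of Mathlib's sorted eigenvalue list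
`hT.eigenvalues hm` (finite-dimensional spectral theorem: `σ(T)` is the set of eigenvalues, all
real; Reed–Simon IV, §XIII.1, pp. 75–76). [cite: ReedSimonIV1978, §XIII.1, pp. 75–76] -/
theorem re_image_spectrum_toContinuousLinearMap {T : E →ₗ[𝕜] E} (hT : T.IsSymmetric) {m : ℕ}
    (hm : Module.finrank 𝕜 E = m) :
    re '' spectrum 𝕜 (LinearMap.toContinuousLinearMap T) = Set.range (hT.eigenvalues hm) := by
  have hspec : spectrum 𝕜 (LinearMap.toContinuousLinearMap T) = spectrum 𝕜 T :=
    AlgEquiv.spectrum_eq (Module.End.toContinuousLinearMap E) T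
  ext x
  simp only [Set.mem_image, Set.mem_range, hspec]
  constructor
  · rintro ⟨μ, hμ, rfl⟩
    obtain ⟨i, hi⟩ :=
      hT.exists_eigenvalues_eq hm (Module.End.hasEigenvalue_iff_mem_spectrum.mpr hμ)
    exact ⟨i, by rw [← hi, RCLike.ofReal_re]⟩
  · rintro ⟨i, rfl⟩
    exact ⟨hT.eigenvalues hm i,
      Module.End.hasEigenvalue_iff_mem_spectrum.mp (hT.hasEigenvalue_eigenvalues hm i),
      RCLike.ofReal_re _⟩

/-- (Dot-notation extension of Mathlib's `LinearMap.IsSymmetric`.) The ground energy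
`inf re σ(T)` of a symmetric operator on a finite-dimensional space of dimension `n + 2` is its
smallest eigenvalue, i.e. the *last* entry `Fin.last (n + 1)` of Mathlib's decreasingly sorted
`eigenvalues` (Reed–Simon IV, §XIII.1, p. 76: `λ₁ = min (ψ, Aψ)/(ψ, ψ)`).
[cite: ReedSimonIV1978, §XIII.1, p. 76] -/
theorem groundEnergy_toContinuousLinearMap {T : E →ₗ[𝕜] E} (hT : T.IsSymmetric) {n : ℕ}
    (hn : Module.finrank 𝕜 E = n + 2) :
    (LinearMap.toContinuousLinearMap T).groundEnergy = hT.eigenvalues hn (Fin.last (n + 1)) := by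
  have h : IsLeast (Set.range (hT.eigenvalues hn)) (hT.eigenvalues hn (Fin.last (n + 1))) :=
    ⟨⟨_, rfl⟩, by rintro _ ⟨i, rfl⟩; exact hT.eigenvalues_antitone hn (Fin.le_last i)⟩
  rw [ContinuousLinearMap.groundEnergy, hT.re_image_spectrum_toContinuousLinearMap hn, h.csInf_eq]

/-- (Dot-notation extension of Mathlib's `LinearMap.IsSymmetric`.) The multiplicity of a real
number `μ` as an eigenvalue of the symmetric operator `T` (the dimension of the eigenspace) is
the number of indices `i` with `hT.eigenvalues hm i = μ`; Mathlib's
`LinearMap.IsSymmetric.card_filter_eigenvalues_eq` restated over `ℝ`. [folklore] -/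
theorem finrank_eigenspace_eq_card_filter {T : E →ₗ[𝕜] E} (hT : T.IsSymmetric) {m : ℕ}
    (hm : Module.finrank 𝕜 E = m) (μ : ℝ) :
    Module.finrank 𝕜 (Module.End.eigenspace T (μ : 𝕜)) =
      Finset.card {i | hT.eigenvalues hm i = μ} := by
  rw [← hT.card_filter_eigenvalues_eq hm (μ : 𝕜)]
  congr 1
  ext i
  simp only [Finset.mem_filter, Finset.mem_univ, true_and, RCLike.ofReal_inj]

variable [CompleteSpace E]

/-- **Discharge** of the named fact `hasSpectralGap_toContinuousLinearMap_iff`: for a symmetric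
`T` on a space of dimension `n + 2`, `toContinuousLinearMap T` has the spectral gap `Δ` iff
`0 < Δ` and (lowest eigenvalue) `+ Δ ≤` (second lowest eigenvalue). Proof as in Reed–Simon IV,
§XIII.1 (finite-dimensional min–max, pp. 75–78): in an orthonormal eigenbasis the spectrum is the
eigenvalue list with multiplicity (`re_image_spectrum_toContinuousLinearMap`,
`finrank_eigenspace_eq_card_filter`), the ground energy is the last = smallest sorted eigenvalue
(`groundEnergy_toContinuousLinearMap`), it is simple iff strictly below the second smallest, and
the gap condition on `σ(T) ∖ {E₀}` is the condition on the second smallest eigenvalue because the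
list is sorted; self-adjointness of `toContinuousLinearMap T` is
`LinearMap.IsSymmetric.isSelfAdjoint`.
[cite: ReedSimonIV1978, Thm. XIII.1 (finite-dimensional min–max), pp. 75–78] -/
theorem hasSpectralGap_toContinuousLinearMap_iff_holds :
    hasSpectralGap_toContinuousLinearMap_iff (𝕜 := 𝕜) (E := E) := by
  intro T hT n hn Δ
  have hsa : IsSelfAdjoint (LinearMap.toContinuousLinearMap T) :=
    LinearMap.IsSymmetric.isSelfAdjoint (A := LinearMap.toContinuousLinearMap T) hT
  have hanti : Antitone (hT.eigenvalues hn) := hT.eigenvalues_antitone hn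
  unfold ContinuousLinearMap.HasSpectralGap
  rw [hT.groundEnergy_toContinuousLinearMap hn, hT.re_image_spectrum_toContinuousLinearMap hn,
    LinearMap.coe_toContinuousLinearMap, hT.finrank_eigenspace_eq_card_filter hn,
    card_filter_eq_last_eq_one_iff hanti]
  constructor
  · rintro ⟨-, hΔ, hlt, hsub⟩
    refine ⟨hΔ, ?_⟩
    rcases hsub (Set.mem_range_self (Fin.castSucc (Fin.last n))) with h | h
    · exact absurd (Set.mem_singleton_iff.mp h) hlt.ne'
    · exact h
  · rintro ⟨hΔ, hgap⟩
    refine ⟨hsa, hΔ, by linarith, ?_⟩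
    rintro _ ⟨i, rfl⟩
    by_cases hi : i = Fin.last (n + 1)
    · exact Or.inl (by simp [hi])
    · exact Or.inr (le_trans hgap (hanti (le_castSucc_last_of_ne_last hi)))

end FiniteDimensional

end LinearMap.IsSymmetric

/-! ### The bridge `hasGroundStateGap_toPMap_iff` (Reed–Simon IV, Theorem XIII.1)

Elementary spectral theory of a bounded self-adjoint operator `T` on a Hilbert space over
`RCLike 𝕜`, relating the resolvent set on the real axis to lower/upper bounds of the quadratic form
`re ⟪T x, x⟫_𝕜`, followed by the discharge `hasGroundStateGap_toPMap_iff_holds`. -/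

open scoped InnerProductSpace ComplexConjugate NNReal

namespace ContinuousLinearMap

/-! #### Step 1: Cauchy–Schwarz for positive operators -/

/-- **Cauchy–Schwarz** for the non-negative Hermitian form `(x, y) ↦ ⟪P x, y⟫_𝕜` of a positive
bounded operator `P`: `‖⟪P x, y⟫_𝕜‖² ≤ re ⟪P x, x⟫_𝕜 · re ⟪P y, y⟫_𝕜`. We borrow Mathlib's abstract
Cauchy–Schwarz inequality for `PreInnerProductSpace.Core`. [folklore] -/
theorem IsPositive.norm_inner_sq_le {P : E →L[𝕜] E} (hP : P.IsPositive) (x y : E) :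
    ‖⟪P x, y⟫_𝕜‖ ^ 2 ≤ re ⟪P x, x⟫_𝕜 * re ⟪P y, y⟫_𝕜 := by
  let c : PreInnerProductSpace.Core 𝕜 E :=
    { inner := fun x y => ⟪P x, y⟫_𝕜
      conj_inner_symm := fun x y => by
        show conj ⟪P y, x⟫_𝕜 = ⟪P x, y⟫_𝕜
        have := hP.isSymmetric.conj_inner_sym y x
        simpa only [coe_coe] using this
      re_inner_nonneg := fun x => hP.re_inner_nonneg_left x
      add_left := fun x y z => by
        show ⟪P (x + y), z⟫_𝕜 = ⟪P x, z⟫_𝕜 + ⟪P y, z⟫_𝕜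
        rw [map_add, inner_add_left]
      smul_left := fun x y r => by
        show ⟪P (r • x), y⟫_𝕜 = conj r * ⟪P x, y⟫_𝕜
        rw [map_smul, inner_smul_left] }
  have h := @InnerProductSpace.Core.inner_mul_inner_self_le 𝕜 E _ _ _ c x y
  change ‖⟪P x, y⟫_𝕜‖ * ‖⟪P y, x⟫_𝕜‖ ≤ re ⟪P x, x⟫_𝕜 * re ⟪P y, y⟫_𝕜 at h
  have hsymm : ‖⟪P y, x⟫_𝕜‖ = ‖⟪P x, y⟫_𝕜‖ := by
    have := hP.isSymmetric.conj_inner_sym x y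
    simp only [coe_coe] at this
    rw [← this, RCLike.norm_conj]
  rw [hsymm, ← sq] at h
  exact h

/-- For a positive bounded operator, `‖P x‖² ≤ ‖P‖ · re ⟪P x, x⟫_𝕜` (Cauchy–Schwarz applied to
`y = P x`). In particular approximate zeros of the form are approximate zeros of `P`. [folklore] -/
theorem IsPositive.norm_apply_sq_le {P : E →L[𝕜] E} (hP : P.IsPositive) (x : E) :
    ‖P x‖ ^ 2 ≤ ‖P‖ * re ⟪P x, x⟫_𝕜 := by
  have hcs := hP.norm_inner_sq_le x (P x)
  have h1 : ‖⟪P x, P x⟫_𝕜‖ = ‖P x‖ ^ 2 := by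
    rw [inner_self_eq_norm_sq_to_K, ← RCLike.ofReal_pow, RCLike.norm_ofReal,
      abs_of_nonneg (sq_nonneg _)]
  have h2 : re ⟪P (P x), P x⟫_𝕜 ≤ ‖P‖ * ‖P x‖ ^ 2 :=
    calc re ⟪P (P x), P x⟫_𝕜 ≤ ‖P (P x)‖ * ‖P x‖ := re_inner_le_norm _ _
      _ ≤ ‖P‖ * ‖P x‖ * ‖P x‖ := by gcongr; exact P.le_opNorm _
      _ = ‖P‖ * ‖P x‖ ^ 2 := by ring
  rw [h1] at hcs
  have h0 : 0 ≤ re ⟪P x, x⟫_𝕜 := hP.re_inner_nonneg_left x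
  have key : ‖P x‖ ^ 2 * ‖P x‖ ^ 2 ≤ ‖P‖ * re ⟪P x, x⟫_𝕜 * ‖P x‖ ^ 2 := by
    calc ‖P x‖ ^ 2 * ‖P x‖ ^ 2 = (‖P x‖ ^ 2) ^ 2 := by ring
      _ ≤ re ⟪P x, x⟫_𝕜 * re ⟪P (P x), P x⟫_𝕜 := hcs
      _ ≤ re ⟪P x, x⟫_𝕜 * (‖P‖ * ‖P x‖ ^ 2) := by gcongr
      _ = ‖P‖ * re ⟪P x, x⟫_𝕜 * ‖P x‖ ^ 2 := by ring
  by_cases hx : P x = 0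
  · simp [hx]
  · exact le_of_mul_le_mul_right key (by positivity)

/-- A positive bounded operator which is invertible is bounded below *in the form sense* by a
positive constant: `ε ‖x‖² ≤ re ⟪P x, x⟫_𝕜`. [folklore] -/
theorem IsPositive.exists_pos_le_re_inner_of_isUnit {P : E →L[𝕜] E} (hP : P.IsPositive)
    (hu : IsUnit P) : ∃ ε : ℝ, 0 < ε ∧ ∀ x, ε * ‖x‖ ^ 2 ≤ re ⟪P x, x⟫_𝕜 := by
  obtain ⟨u, rfl⟩ := hu
  set C : ℝ := ‖((u⁻¹ : (E →L[𝕜] E)ˣ) : E →L[𝕜] E)‖ ^ 2 * ‖(u : E →L[𝕜] E)‖ with hC_def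
  have hC0 : 0 ≤ C := by positivity
  have key : ∀ x, ‖x‖ ^ 2 ≤ C * re ⟪(u : E →L[𝕜] E) x, x⟫_𝕜 := by
    intro x
    have hinv : ((u⁻¹ : (E →L[𝕜] E)ˣ) : E →L[𝕜] E) ((u : E →L[𝕜] E) x) = x := by
      show (((u⁻¹ : (E →L[𝕜] E)ˣ) : E →L[𝕜] E) * (u : E →L[𝕜] E)) x = x
      rw [u.inv_mul]
      rfl
    have hx : ‖x‖ ≤ ‖((u⁻¹ : (E →L[𝕜] E)ˣ) : E →L[𝕜] E)‖ * ‖(u : E →L[𝕜] E) x‖ := by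
      conv_lhs => rw [← hinv]
      exact le_opNorm _ _
    calc ‖x‖ ^ 2 ≤ (‖((u⁻¹ : (E →L[𝕜] E)ˣ) : E →L[𝕜] E)‖ * ‖(u : E →L[𝕜] E) x‖) ^ 2 := by
          gcongr
      _ = ‖((u⁻¹ : (E →L[𝕜] E)ˣ) : E →L[𝕜] E)‖ ^ 2 * ‖(u : E →L[𝕜] E) x‖ ^ 2 := by ring
      _ ≤ ‖((u⁻¹ : (E →L[𝕜] E)ˣ) : E →L[𝕜] E)‖ ^ 2 * (‖(u : E →L[𝕜] E)‖ *
            re ⟪(u : E →L[𝕜] E) x, x⟫_𝕜) := by gcongr; exact hP.norm_apply_sq_le x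
      _ = C * re ⟪(u : E →L[𝕜] E) x, x⟫_𝕜 := by rw [hC_def]; ring
  rcases hC0.lt_or_eq with hCpos | hCzero
  · refine ⟨C⁻¹, inv_pos.mpr hCpos, fun x => ?_⟩
    rw [inv_mul_le_iff₀ hCpos]
    exact key x
  · refine ⟨1, one_pos, fun x => ?_⟩
    have hx : ‖x‖ ^ 2 ≤ 0 := by simpa [← hCzero] using key x
    have hx0 : ‖x‖ ^ 2 = 0 := le_antisymm hx (sq_nonneg _)
    rw [hx0, mul_zero]
    exact hP.re_inner_nonneg_left x

/-! #### Step 2: real shifts of a self-adjoint operator -/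

/-- The form of the real shift `S - μ`: `re ⟪(S - μ) x, x⟫_𝕜 = re ⟪S x, x⟫_𝕜 - μ ‖x‖²`. [folklore] -/
theorem re_inner_sub_real_smul_one_apply (S : E →L[𝕜] E) (μ : ℝ) (x : E) :
    re ⟪(S - (μ : 𝕜) • (1 : E →L[𝕜] E)) x, x⟫_𝕜 = re ⟪S x, x⟫_𝕜 - μ * ‖x‖ ^ 2 := by
  simp only [sub_apply, smul_apply, one_apply_eq_self, inner_sub_left,
    inner_smul_left, map_sub, RCLike.conj_ofReal, RCLike.re_ofReal_mul, inner_self_eq_norm_sq]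

section Shift

variable [CompleteSpace E]

/-- A real shift of a self-adjoint operator is self-adjoint. [folklore] -/
theorem _root_.IsSelfAdjoint.sub_real_smul_one {S : E →L[𝕜] E} (hS : IsSelfAdjoint S) (μ : ℝ) :
    IsSelfAdjoint (S - (μ : 𝕜) • (1 : E →L[𝕜] E)) := by
  rw [isSelfAdjoint_iff_isSymmetric]
  intro x y
  simp only [coe_coe, sub_apply, smul_apply, one_apply_eq_self, inner_sub_left,
    inner_sub_right, inner_smul_left, inner_smul_right, RCLike.conj_ofReal,
    hS.isSymmetric.apply_clm x y]

/-- **Bottom of the spectrum bounds the form from below.** If `S` is self-adjoint and `S - μ` is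
invertible for every real `μ < a`, then `a ‖x‖² ≤ re ⟪S x, x⟫_𝕜` for all `x`. Proof by continuous
induction on the lower bound: the set of form lower bounds is closed, contains `-‖S‖`, and has no
maximal element below `a`, because a positive invertible operator is bounded below by a positive
constant (`IsPositive.exists_pos_le_re_inner_of_isUnit`). This is the elementary half of
"`inf σ(S)` is the bottom of the numerical range" for bounded self-adjoint operators. [folklore] -/
theorem re_inner_ge_of_forall_lt_isUnit {S : E →L[𝕜] E} (hS : IsSelfAdjoint S) (a : ℝ)
    (h : ∀ μ : ℝ, μ < a → IsUnit (S - (μ : 𝕜) • (1 : E →L[𝕜] E))) (x : E) :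
    a * ‖x‖ ^ 2 ≤ re ⟪S x, x⟫_𝕜 := by
  -- the set of form lower bounds of `S`
  let s : Set ℝ := {μ | ∀ x, μ * ‖x‖ ^ 2 ≤ re ⟪S x, x⟫_𝕜}
  have hs_closed : IsClosed s := by
    have hs : s = ⋂ x : E, {μ : ℝ | μ * ‖x‖ ^ 2 ≤ re ⟪S x, x⟫_𝕜} := by
      ext μ
      simp [s]
    rw [hs]
    exact isClosed_iInter fun x =>
      isClosed_le (continuous_id.mul continuous_const) continuous_const
  have h0 : -‖S‖ ∈ s := by
    intro x
    have h1 : |re ⟪S x, x⟫_𝕜| ≤ ‖S‖ * ‖x‖ ^ 2 :=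
      calc |re ⟪S x, x⟫_𝕜| ≤ ‖⟪S x, x⟫_𝕜‖ := RCLike.abs_re_le_norm _
        _ ≤ ‖S x‖ * ‖x‖ := norm_inner_le_norm _ _
        _ ≤ ‖S‖ * ‖x‖ * ‖x‖ := by gcongr; exact S.le_opNorm x
        _ = ‖S‖ * ‖x‖ ^ 2 := by ring
    have := neg_abs_le (re ⟪S x, x⟫_𝕜)
    linarith
  suffices ha : a ∈ s from ha x
  rcases le_or_gt a (-‖S‖) with hle | hlt
  · exact fun x => (mul_le_mul_of_nonneg_right hle (sq_nonneg _)).trans (h0 x)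
  refine (hs_closed.inter isClosed_Icc).mem_of_ge_of_forall_exists_gt h0 hlt.le ?_
  rintro μ ⟨hμs, -, hμa⟩
  -- `S - μ` is positive (as `μ` is a form lower bound) and invertible (as `μ < a`)
  have hpos : (S - (μ : 𝕜) • (1 : E →L[𝕜] E)).IsPositive := by
    refine ⟨(hS.sub_real_smul_one μ).isSymmetric, fun x => ?_⟩
    rw [reApplyInnerSelf_apply, re_inner_sub_real_smul_one_apply, sub_nonneg]
    exact hμs x
  obtain ⟨ε, hε, hbound⟩ := hpos.exists_pos_le_re_inner_of_isUnit (h μ hμa)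
  refine ⟨min (μ + ε) a, ?_, lt_min (by linarith) hμa, min_le_right _ _⟩
  intro x
  have hx := hbound x
  rw [re_inner_sub_real_smul_one_apply] at hx
  have : min (μ + ε) a * ‖x‖ ^ 2 ≤ (μ + ε) * ‖x‖ ^ 2 :=
    mul_le_mul_of_nonneg_right (min_le_left _ _) (sq_nonneg _)
  linarith

/-- Upper-bound version of `re_inner_ge_of_forall_lt_isUnit`: if `S - μ` is invertible for every
real `μ > a`, then `re ⟪S x, x⟫_𝕜 ≤ a ‖x‖²`. [folklore] -/
theorem re_inner_le_of_forall_gt_isUnit {S : E →L[𝕜] E} (hS : IsSelfAdjoint S) (a : ℝ)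
    (h : ∀ μ : ℝ, a < μ → IsUnit (S - (μ : 𝕜) • (1 : E →L[𝕜] E))) (x : E) :
    re ⟪S x, x⟫_𝕜 ≤ a * ‖x‖ ^ 2 := by
  have hneg : ∀ μ : ℝ, μ < -a → IsUnit (-S - (μ : 𝕜) • (1 : E →L[𝕜] E)) := by
    intro μ hμ
    have hu := (h (-μ) (by linarith)).neg
    have heq : -(S - ((-μ : ℝ) : 𝕜) • (1 : E →L[𝕜] E)) = -S - (μ : 𝕜) • (1 : E →L[𝕜] E) := by
      rw [RCLike.ofReal_neg, neg_smul, sub_neg_eq_add, neg_add', ]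
    rwa [heq] at hu
  have := re_inner_ge_of_forall_lt_isUnit hS.neg (-a) hneg x
  rw [neg_apply, inner_neg_left, map_neg] at this
  linarith

end Shift

/-! #### Step 3: spectrum, units, and the resolvent bound across a gap -/

/-- `μ ∈ σ(T)` iff `T - μ` is not invertible (Mathlib's `spectrum.mem_iff`, rearranged). [folklore] -/
theorem mem_spectrum_iff_not_isUnit (T : E →L[𝕜] E) (μ : 𝕜) :
    μ ∈ spectrum 𝕜 T ↔ ¬IsUnit (T - μ • (1 : E →L[𝕜] E)) := by
  rw [spectrum.mem_iff, Algebra.algebraMap_eq_smul_one, ← IsUnit.neg_iff, neg_sub]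

section Resolvent

variable [CompleteSpace E]

/-- A self-adjoint operator which is bounded below, `c ‖x‖ ≤ ‖A x‖` with `0 < c`, is invertible:
it is injective with closed range (`bijective_iff_dense_range_and_antilipschitz`), and its range
is dense because `(range A)ᗮ = ker A† = ker A = 0`. [folklore] -/
theorem isUnit_of_isSelfAdjoint_of_forall_le_norm {A : E →L[𝕜] E} (hA : IsSelfAdjoint A)
    {c : ℝ} (hc : 0 < c) (h : ∀ x, c * ‖x‖ ≤ ‖A x‖) : IsUnit A := by
  rw [isUnit_iff_bijective, bijective_iff_dense_range_and_antilipschitz]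
  have anti : AntilipschitzWith (Real.toNNReal c⁻¹) A := by
    refine A.antilipschitz_of_bound (K := Real.toNNReal c⁻¹) fun x => ?_
    rw [Real.coe_toNNReal _ (inv_nonneg.mpr hc.le), inv_mul_eq_div, le_div_iff₀ hc, mul_comm]
    exact h x
  refine ⟨?_, _, anti⟩
  rw [Submodule.topologicalClosure_eq_top_iff, orthogonal_range, hA.adjoint_eq]
  exact LinearMap.ker_eq_bot.mpr anti.injective

/-- **Resolvent form bound across a spectral gap.** Let `T` be self-adjoint and suppose that
`T - ν` is invertible for every real `ν ∈ [a, b)`. Then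
`(b - a) · re ⟪(T - a) x, x⟫_𝕜 ≤ ‖(T - a) x‖²` for all `x`.
Proof: `B := (T - a)⁻¹` is self-adjoint and, by the algebra `B - κ = -κ B (T - (a + κ⁻¹))`,
`B - κ` is invertible for all `κ > (b - a)⁻¹`; hence `re ⟪B y, y⟫_𝕜 ≤ (b - a)⁻¹ ‖y‖²`
(`re_inner_le_of_forall_gt_isUnit`); put `y = (T - a) x`. (Spectrally: `(t - a)(t - b) ≥ 0` off
`(a, b)`; this is the operator-norm-free form of `‖(T - c)⁻¹‖ = dist(c, σ(T))⁻¹` for self-adjoint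
`T`.) [folklore] -/
theorem re_inner_shift_le_of_gap {T : E →L[𝕜] E} (hT : IsSelfAdjoint T) {a b : ℝ} (hab : a < b)
    (h : ∀ ν : ℝ, a ≤ ν → ν < b → IsUnit (T - (ν : 𝕜) • (1 : E →L[𝕜] E))) (x : E) :
    (b - a) * re ⟪(T - (a : 𝕜) • (1 : E →L[𝕜] E)) x, x⟫_𝕜 ≤
      ‖(T - (a : 𝕜) • (1 : E →L[𝕜] E)) x‖ ^ 2 := by
  set A := T - (a : 𝕜) • (1 : E →L[𝕜] E) with hA_def
  have hA : IsSelfAdjoint A := hT.sub_real_smul_one a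
  have hAu : IsUnit A := h a le_rfl hab
  set B := Ring.inverse A with hB_def
  have hB : IsSelfAdjoint B := hA.ringInverse
  have hBA : B * A = 1 := Ring.inverse_mul_cancel A hAu
  have hAB : A * B = 1 := Ring.mul_inverse_cancel A hAu
  have hBu : IsUnit B := ⟨⟨B, A, hBA, hAB⟩, rfl⟩
  have hba : 0 < b - a := sub_pos.mpr hab
  -- `B - κ` is invertible for `κ > (b - a)⁻¹`
  have hBunit : ∀ κ : ℝ, (b - a)⁻¹ < κ → IsUnit (B - (κ : 𝕜) • (1 : E →L[𝕜] E)) := by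
    intro κ hκ
    have hκpos : 0 < κ := (inv_pos.mpr hba).trans hκ
    have hκinv : κ⁻¹ < b - a := (inv_lt_comm₀ hba hκpos).mp hκ
    have hκ0 : (κ : 𝕜) ≠ 0 := by exact_mod_cast hκpos.ne'
    -- `A - κ⁻¹ = T - (a + κ⁻¹)` is a unit
    have hu : IsUnit (A - ((κ⁻¹ : ℝ) : 𝕜) • (1 : E →L[𝕜] E)) := by
      have := h (a + κ⁻¹) (by linarith [inv_pos.mpr hκpos]) (by linarith)
      rw [hA_def, sub_sub, ← add_smul, ← RCLike.ofReal_add]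
      exact this
    -- `B - κ = (-κ) • (B (A - κ⁻¹))`
    have heq : (-(κ : 𝕜)) • (B * (A - ((κ⁻¹ : ℝ) : 𝕜) • (1 : E →L[𝕜] E))) =
        B - (κ : 𝕜) • (1 : E →L[𝕜] E) := by
      have hsc : (-(κ : 𝕜)) * ((κ⁻¹ : ℝ) : 𝕜) = -1 := by
        rw [RCLike.ofReal_inv, neg_mul, mul_inv_cancel₀ hκ0]
      rw [mul_sub, mul_smul_comm, mul_one, hBA, smul_sub, smul_smul, hsc, neg_one_smul, neg_smul,
        sub_neg_eq_add]
      abel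
    have hscalar : IsUnit ((-(κ : 𝕜)) • (1 : E →L[𝕜] E)) := by
      rw [← Algebra.algebraMap_eq_smul_one]
      exact (isUnit_iff_ne_zero.mpr (neg_ne_zero.mpr hκ0)).map _
    rw [← heq, ← smul_one_mul]
    exact hscalar.mul (hBu.mul hu)
  -- the form bound for `B`, evaluated at `y = A x`
  have hBform : re ⟪B (A x), A x⟫_𝕜 ≤ (b - a)⁻¹ * ‖A x‖ ^ 2 :=
    re_inner_le_of_forall_gt_isUnit hB _ hBunit (A x)
  have hBAx : B (A x) = x := by
    show (B * A) x = x
    rw [hBA]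
    rfl
  rw [hBAx, inner_re_symm, inv_mul_eq_div, le_div_iff₀ hba] at hBform
  linarith

/-- **The gap inequality on the range, quadratic form.** If `T` is self-adjoint, `0 < Δ`, and
`T - ν` is invertible for all real `ν ∈ (0, Δ)`, then `Δ · re ⟪T x, x⟫_𝕜 ≤ ‖T x‖²` for all `x`
(let `a → 0⁺` in `re_inner_shift_le_of_gap` with `b = Δ`). [folklore] -/
theorem gap_mul_re_inner_le_norm_sq {T : E →L[𝕜] E} (hT : IsSelfAdjoint T) {Δ : ℝ}
    (hΔ : 0 < Δ) (h : ∀ ν : ℝ, 0 < ν → ν < Δ → IsUnit (T - (ν : 𝕜) • (1 : E →L[𝕜] E)))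
    (x : E) : Δ * re ⟪T x, x⟫_𝕜 ≤ ‖T x‖ ^ 2 := by
  have key : ∀ a : ℝ, 0 < a → a < Δ →
      (Δ - a) * re ⟪(T - (a : 𝕜) • (1 : E →L[𝕜] E)) x, x⟫_𝕜 ≤
        ‖(T - (a : 𝕜) • (1 : E →L[𝕜] E)) x‖ ^ 2 :=
    fun a ha haΔ => re_inner_shift_le_of_gap hT haΔ (fun ν hν hνΔ => h ν (ha.trans_le hν) hνΔ) x
  have happly : ∀ a : ℝ, (T - (a : 𝕜) • (1 : E →L[𝕜] E)) x = T x - (a : 𝕜) • x := fun a => by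
    simp only [sub_apply, smul_apply, one_apply_eq_self]
  have hcont1 : Continuous fun a : ℝ =>
      (Δ - a) * re ⟪(T - (a : 𝕜) • (1 : E →L[𝕜] E)) x, x⟫_𝕜 := by
    simp only [re_inner_sub_real_smul_one_apply]
    fun_prop
  have hcont2 : Continuous fun a : ℝ => ‖(T - (a : 𝕜) • (1 : E →L[𝕜] E)) x‖ ^ 2 := by
    simp only [happly]
    exact ((continuous_const.sub (RCLike.continuous_ofReal.smul continuous_const)).norm).pow 2
  have h1 := (hcont1.tendsto 0).mono_left (nhdsWithin_le_nhds (s := Set.Ioi (0 : ℝ)))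
  have h2 := (hcont2.tendsto 0).mono_left (nhdsWithin_le_nhds (s := Set.Ioi (0 : ℝ)))
  have hev : ∀ᶠ a : ℝ in nhdsWithin (0 : ℝ) (Set.Ioi 0),
      (Δ - a) * re ⟪(T - (a : 𝕜) • (1 : E →L[𝕜] E)) x, x⟫_𝕜 ≤
        ‖(T - (a : 𝕜) • (1 : E →L[𝕜] E)) x‖ ^ 2 := by
    filter_upwards [Ioo_mem_nhdsGT hΔ] with a ha using key a ha.1 ha.2
  have := le_of_tendsto_of_tendsto h1 h2 hev
  simpa [happly] using this

/-- **The gap inequality on the range.** If `T` is positive, `0 < Δ`, and `T - ν` is invertible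
for all real `ν ∈ (0, Δ)`, then `T ≥ Δ` in the form sense on `range T`:
`Δ ‖T x‖² ≤ re ⟪T (T x), T x⟫_𝕜`. Proof: Cauchy–Schwarz for the form of `T` gives
`‖T x‖⁴ = |⟪T (T x), x⟫_𝕜|² ≤ re ⟪T (T x), T x⟫_𝕜 · re ⟪T x, x⟫_𝕜`, and
`Δ · re ⟪T x, x⟫_𝕜 ≤ ‖T x‖²` by `gap_mul_re_inner_le_norm_sq`. [folklore] -/
theorem gap_le_re_inner_on_range {T : E →L[𝕜] E} (hTpos : T.IsPositive) {Δ : ℝ} (hΔ : 0 < Δ)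
    (h : ∀ ν : ℝ, 0 < ν → ν < Δ → IsUnit (T - (ν : 𝕜) • (1 : E →L[𝕜] E))) (x : E) :
    Δ * ‖T x‖ ^ 2 ≤ re ⟪T (T x), T x⟫_𝕜 := by
  have h1 := gap_mul_re_inner_le_norm_sq hTpos.isSelfAdjoint hΔ h x
  have hcs := hTpos.norm_inner_sq_le (T x) x
  have h2 : ⟪T (T x), x⟫_𝕜 = ⟪T x, T x⟫_𝕜 := hTpos.isSymmetric.apply_clm (T x) x
  rw [h2, inner_self_eq_norm_sq_to_K, ← RCLike.ofReal_pow, RCLike.norm_ofReal,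
    abs_of_nonneg (sq_nonneg _)] at hcs
  have h0 : 0 ≤ re ⟪T (T x), T x⟫_𝕜 := hTpos.re_inner_nonneg_left (T x)
  by_cases hx : T x = 0
  · simp [hx]
  have hpos : 0 < ‖T x‖ ^ 2 := by positivity
  have key : Δ * ‖T x‖ ^ 2 * ‖T x‖ ^ 2 ≤ re ⟪T (T x), T x⟫_𝕜 * ‖T x‖ ^ 2 :=
    calc Δ * ‖T x‖ ^ 2 * ‖T x‖ ^ 2 = Δ * (‖T x‖ ^ 2) ^ 2 := by ring
      _ ≤ Δ * (re ⟪T (T x), T x⟫_𝕜 * re ⟪T x, x⟫_𝕜) :=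
          mul_le_mul_of_nonneg_left hcs hΔ.le
      _ = re ⟪T (T x), T x⟫_𝕜 * (Δ * re ⟪T x, x⟫_𝕜) := by ring
      _ ≤ re ⟪T (T x), T x⟫_𝕜 * ‖T x‖ ^ 2 := mul_le_mul_of_nonneg_left h1 h0
  exact le_of_mul_le_mul_right key hpos

end Resolvent

/-! #### Step 4: the discharge -/

section Discharge

variable [CompleteSpace E]

/-- **Discharge** of the named fact `ContinuousLinearMap.hasGroundStateGap_toPMap_iff`
(Reed–Simon IV, Theorem XIII.1, min–max principle, specialised to a bounded self-adjoint `T ≥ 0`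
with ground state `Ω`, `T Ω = 0`): the `LinearPMap` `T.toPMap ⊤` has the ground-state gap `Δ` at
`Ω` (self-adjoint, positive, `T ≥ Δ` in the form sense on `{Ω}ᗮ`) iff `T` has the spectral gap
`Δ` (`ker T` one-dimensional and `re σ(T) ⊆ {0} ∪ [Δ, ∞)`).

The printed proof of Theorem XIII.1 uses the spectral measure of `T`; Mathlib has no spectral
theorem for bounded self-adjoint operators over `RCLike 𝕜`, so both directions are proved here by
the elementary numerical-range/resolvent arguments of Steps 1–3:
(⇒) `ker T = 𝕜 ∙ Ω` is `LinearPMap.HasFormGap.kernel_eq_span_holds`; for `μ` with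
`re μ ∉ {0} ∪ [Δ, ∞)` the operator `T - μ` is invertible — by coercivity
(`isUnit_of_forall_le_norm_inner_map`) when `im μ ≠ 0` or `re μ < 0`, and, when `0 < μ < Δ`,
because it is bounded below by `min μ (Δ - μ)` on `E = 𝕜Ω ⊕ {Ω}ᗮ`
(`isUnit_of_isSelfAdjoint_of_forall_le_norm`).
(⇐) real points off `{0} ∪ [Δ, ∞)` are in the resolvent set, so `T ≥ 0`
(`re_inner_ge_of_forall_lt_isUnit`), `T ≥ Δ` on `range T` (`gap_le_re_inner_on_range`), hence
on its closure `(ker T)ᗮ = (𝕜 ∙ Ω)ᗮ` (`orthogonal_ker`, `finrank (ker T) = 1`); self-adjointness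
of `T.toPMap ⊤` is Mathlib's `ContinuousLinearMap.toPMap_adjoint_eq_adjoint_toPMap_of_dense`.
[cite: ReedSimonIV1978, Thm. XIII.1 (min–max principle), §XIII.1 p. 76] -/
theorem hasGroundStateGap_toPMap_iff_holds :
    hasGroundStateGap_toPMap_iff (𝕜 := 𝕜) (E := E) := by
  intro T hT h0 Ω hΩ0 hΩ Δ
  have hsymm := hT.isSymmetric
  -- `T` maps `{Ω}ᗮ` into itself
  have hTK : ∀ y ∈ (𝕜 ∙ Ω)ᗮ, T y ∈ (𝕜 ∙ Ω)ᗮ := by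
    intro y hy
    rw [Submodule.mem_orthogonal_singleton_iff_inner_right] at hy ⊢
    rw [← hsymm.apply_clm, hΩ, inner_zero_left]
  constructor
  · -- (⇒) form gap ⇒ spectral gap
    rintro ⟨-, hfg⟩
    obtain ⟨hpos, -, ⟨hΩd, hAΩ⟩, hΔ, hbd⟩ := id hfg
    have hform0 : ∀ x, 0 ≤ re ⟪T x, x⟫_𝕜 := fun x => by
      have := hpos.2 ⟨x, Submodule.mem_top⟩
      simp only [LinearMap.toPMap_apply, coe_coe] at this
      rwa [inner_re_symm]
    have hformK : ∀ y ∈ (𝕜 ∙ Ω)ᗮ, Δ * ‖y‖ ^ 2 ≤ re ⟪T y, y⟫_𝕜 := fun y hy => by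
      have := hbd ⟨y, Submodule.mem_top⟩ hy
      simp only [LinearMap.toPMap_apply, coe_coe] at this
      rwa [inner_re_symm]
    refine ⟨hT, hΔ, ?_, ?_⟩
    · -- the ground energy `0` is a simple eigenvalue
      have hker : ((T : E →ₗ[𝕜] E).toPMap ⊤).kernel = 𝕜 ∙ Ω :=
        LinearPMap.HasFormGap.kernel_eq_span_holds hfg
      have heig : Module.End.eigenspace (T : E →ₗ[𝕜] E) 0 = 𝕜 ∙ Ω := by
        rw [← LinearPMap.eigenspace_toPMap_top]
        exact hker
      rw [h0, RCLike.ofReal_zero, heig]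
      exact finrank_span_singleton hΩ0
    · -- the spectrum away from `0` lies in `[Δ, ∞)`
      rw [h0, zero_add]
      rintro _ ⟨μ, hμ, rfl⟩
      by_contra hcon
      simp only [Set.mem_union, Set.mem_singleton_iff, Set.mem_Ici, not_or, not_le] at hcon
      obtain ⟨hre0, hreΔ⟩ := hcon
      refine (mem_spectrum_iff_not_isUnit T μ).mp hμ ?_
      rcases ne_or_eq (im μ) 0 with him | him
      · -- `im μ ≠ 0`: `|⟪(T - μ) x, x⟫_𝕜| ≥ |im μ| ‖x‖²`
        refine isUnit_of_forall_le_norm_inner_map _ (c := Real.toNNReal |im μ|)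
          (Real.toNNReal_pos.mpr (abs_pos.mpr him)) fun x => ?_
        rw [Real.coe_toNNReal _ (abs_nonneg _)]
        have hTim : im ⟪T x, x⟫_𝕜 = 0 := by
          have := hsymm.im_inner_apply_self x
          simpa only [coe_coe] using this
        have hcalc : im ⟪(T - μ • (1 : E →L[𝕜] E)) x, x⟫_𝕜 = im μ * ‖x‖ ^ 2 := by
          simp only [sub_apply, smul_apply, one_apply_eq_self, inner_sub_left, inner_smul_left,
            map_sub, RCLike.mul_im, RCLike.conj_re, RCLike.conj_im, inner_self_im, mul_zero,
            zero_add, hTim, inner_self_eq_norm_sq]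
          ring
        calc ‖x‖ ^ 2 * |im μ| = |im ⟪(T - μ • (1 : E →L[𝕜] E)) x, x⟫_𝕜| := by
              rw [hcalc, abs_mul, abs_of_nonneg (sq_nonneg ‖x‖), mul_comm]
          _ ≤ ‖⟪(T - μ • (1 : E →L[𝕜] E)) x, x⟫_𝕜‖ := RCLike.abs_im_le_norm _
      · -- `μ` is real
        have hμ_eq : μ = ((re μ : ℝ) : 𝕜) := by
          apply RCLike.ext <;> simp [him]
        rw [hμ_eq]
        rcases lt_or_gt_of_ne hre0 with ha | ha
        · -- `re μ < 0`: `T - μ ≥ -μ > 0` is coercive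
          refine isUnit_of_forall_le_norm_inner_map _ (c := Real.toNNReal (-re μ))
            (Real.toNNReal_pos.mpr (by linarith)) fun x => ?_
          rw [Real.coe_toNNReal _ (by linarith)]
          have h1 := re_inner_sub_real_smul_one_apply T (re μ) x
          have h2 := hform0 x
          calc ‖x‖ ^ 2 * -re μ ≤ re ⟪(T - ((re μ : ℝ) : 𝕜) • (1 : E →L[𝕜] E)) x, x⟫_𝕜 := by
                rw [h1]; nlinarith [sq_nonneg ‖x‖]
            _ ≤ ‖⟪(T - ((re μ : ℝ) : 𝕜) • (1 : E →L[𝕜] E)) x, x⟫_𝕜‖ := RCLike.re_le_norm _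
        · -- `0 < re μ < Δ`: `T - μ` is bounded below by `min μ (Δ - μ)` on `𝕜Ω ⊕ {Ω}ᗮ`
          set a : ℝ := re μ with ha_def
          set A := T - (a : 𝕜) • (1 : E →L[𝕜] E) with hA_def
          refine isUnit_of_isSelfAdjoint_of_forall_le_norm (hT.sub_real_smul_one a)
            (c := min a (Δ - a)) (lt_min ha (by linarith)) fun x => ?_
          obtain ⟨p, hp, y, hy, rfl⟩ := Submodule.exists_add_mem_mem_orthogonal (K := 𝕜 ∙ Ω) x
          have hTp : T p = 0 := by
            obtain ⟨t, rfl⟩ := Submodule.mem_span_singleton.mp hp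
            rw [map_smul, hΩ, smul_zero]
          have hApply : ∀ z, A z = T z - (a : 𝕜) • z := fun z => by
            simp only [hA_def, sub_apply, smul_apply, one_apply_eq_self]
          have hAp : A p = -((a : 𝕜) • p) := by rw [hApply, hTp, zero_sub]
          have hAp_mem : A p ∈ 𝕜 ∙ Ω := by
            rw [hAp]
            exact Submodule.neg_mem _ (Submodule.smul_mem _ _ hp)
          have hAy_mem : A y ∈ (𝕜 ∙ Ω)ᗮ := by
            rw [hApply]
            exact Submodule.sub_mem _ (hTK y hy) (Submodule.smul_mem _ _ hy)
          have hxnorm : ‖p + y‖ ^ 2 = ‖p‖ ^ 2 + ‖y‖ ^ 2 := by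
            have := norm_add_sq_eq_norm_sq_add_norm_sq_of_inner_eq_zero p y
              (Submodule.inner_right_of_mem_orthogonal hp hy)
            simpa only [sq] using this
          have hAnorm : ‖A (p + y)‖ ^ 2 = ‖A p‖ ^ 2 + ‖A y‖ ^ 2 := by
            rw [map_add]
            have := norm_add_sq_eq_norm_sq_add_norm_sq_of_inner_eq_zero (A p) (A y)
              (Submodule.inner_right_of_mem_orthogonal hAp_mem hAy_mem)
            simpa only [sq] using this
          have hAp_norm : ‖A p‖ = a * ‖p‖ := by
            rw [hAp, norm_neg, norm_smul, RCLike.norm_ofReal, abs_of_pos ha]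
          have hAy_norm : (Δ - a) * ‖y‖ ≤ ‖A y‖ := by
            have h1 : (Δ - a) * ‖y‖ ^ 2 ≤ re ⟪A y, y⟫_𝕜 := by
              rw [hA_def, re_inner_sub_real_smul_one_apply]
              have := hformK y hy
              linarith
            have h2 : re ⟪A y, y⟫_𝕜 ≤ ‖A y‖ * ‖y‖ := re_inner_le_norm _ _
            by_cases hy0 : y = 0
            · simp [hy0]
            · have hypos : 0 < ‖y‖ := norm_pos_iff.mpr hy0
              refine le_of_mul_le_mul_right ?_ hypos
              calc (Δ - a) * ‖y‖ * ‖y‖ = (Δ - a) * ‖y‖ ^ 2 := by ring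
                _ ≤ ‖A y‖ * ‖y‖ := h1.trans h2
          have hc0 : 0 ≤ min a (Δ - a) := le_min ha.le (by linarith)
          have hsq : (min a (Δ - a) * ‖p + y‖) ^ 2 ≤ ‖A (p + y)‖ ^ 2 := by
            rw [mul_pow, hxnorm, hAnorm, hAp_norm, mul_add]
            gcongr ?_ + ?_
            · rw [mul_pow]
              exact mul_le_mul_of_nonneg_right
                (pow_le_pow_left₀ hc0 (min_le_left _ _) 2) (sq_nonneg _)
            · calc min a (Δ - a) ^ 2 * ‖y‖ ^ 2 = (min a (Δ - a) * ‖y‖) ^ 2 := by ring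
                _ ≤ ((Δ - a) * ‖y‖) ^ 2 :=
                    pow_le_pow_left₀ (mul_nonneg hc0 (norm_nonneg _))
                      (mul_le_mul_of_nonneg_right (min_le_right _ _) (norm_nonneg _)) 2
                _ ≤ ‖A y‖ ^ 2 :=
                    pow_le_pow_left₀ (mul_nonneg (by linarith) (norm_nonneg _)) hAy_norm 2
          exact (pow_le_pow_iff_left₀ (mul_nonneg hc0 (norm_nonneg _)) (norm_nonneg _)
            two_ne_zero).mp hsq
  · -- (⇐) spectral gap ⇒ form gap
    rintro ⟨-, hΔ, hfin, hspec⟩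
    rw [h0, RCLike.ofReal_zero] at hfin
    rw [h0, zero_add] at hspec
    -- real points off `{0} ∪ [Δ, ∞)` are in the resolvent set
    have hunit : ∀ ν : ℝ, ν ≠ 0 → ν < Δ → IsUnit (T - (ν : 𝕜) • (1 : E →L[𝕜] E)) := by
      intro ν hν0 hνΔ
      by_contra hnu
      have hmem : (ν : 𝕜) ∈ spectrum 𝕜 T := (mem_spectrum_iff_not_isUnit T ν).mpr hnu
      have := hspec (Set.mem_image_of_mem re hmem)
      rw [RCLike.ofReal_re] at this
      rcases this with h | h
      · exact hν0 (Set.mem_singleton_iff.mp h)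
      · exact absurd (Set.mem_Ici.mp h) (not_le.mpr hνΔ)
    -- `T ≥ 0`
    have hform0 : ∀ x, 0 ≤ re ⟪T x, x⟫_𝕜 := fun x => by
      have := re_inner_ge_of_forall_lt_isUnit hT 0
        (fun μ hμ => hunit μ hμ.ne (hμ.trans hΔ)) x
      simpa using this
    have hTpos : T.IsPositive :=
      ⟨hsymm, fun x => by rw [reApplyInnerSelf_apply]; exact hform0 x⟩
    -- `ker T = 𝕜 ∙ Ω`
    have hker : LinearMap.ker (T : E →ₗ[𝕜] E) = 𝕜 ∙ Ω := by
      have hle : (𝕜 ∙ Ω) ≤ Module.End.eigenspace (T : E →ₗ[𝕜] E) 0 := by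
        rw [Submodule.span_le, Set.singleton_subset_iff, SetLike.mem_coe,
          Module.End.mem_eigenspace_iff]
        simp [hΩ]
      haveI : FiniteDimensional 𝕜 (Module.End.eigenspace (T : E →ₗ[𝕜] E) 0) :=
        Module.finite_of_finrank_eq_succ hfin
      have heq := Submodule.eq_of_le_of_finrank_eq hle
        (by rw [hfin, finrank_span_singleton hΩ0])
      rw [heq, Module.End.eigenspace_zero]
    -- `T ≥ Δ` on `range T`, hence on its closure `(ker T)ᗮ = (𝕜 ∙ Ω)ᗮ`
    have hrange : ∀ x, Δ * ‖T x‖ ^ 2 ≤ re ⟪T (T x), T x⟫_𝕜 :=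
      gap_le_re_inner_on_range hTpos hΔ (fun ν hν hνΔ => hunit ν hν.ne' hνΔ)
    have hK : ∀ y ∈ (𝕜 ∙ Ω)ᗮ, Δ * ‖y‖ ^ 2 ≤ re ⟪T y, y⟫_𝕜 := by
      have hcl : ((𝕜 ∙ Ω)ᗮ : Set E) ⊆
          closure (LinearMap.range (T : E →ₗ[𝕜] E) : Set E) := by
        have h1 : (𝕜 ∙ Ω)ᗮ = (LinearMap.range (T : E →ₗ[𝕜] E)).topologicalClosure := by
          rw [← hker]
          have := orthogonal_ker T
          rw [hT.adjoint_eq] at this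
          exact this
        rw [h1, Submodule.topologicalClosure_coe]
      have hclosed : IsClosed {y : E | Δ * ‖y‖ ^ 2 ≤ re ⟪T y, y⟫_𝕜} :=
        isClosed_le (continuous_const.mul (continuous_norm.pow 2))
          (continuous_re.comp (T.continuous.inner continuous_id))
      intro y hy
      refine (hclosed.closure_subset_iff.mpr ?_) (hcl hy)
      rintro _ ⟨x, rfl⟩
      exact hrange x
    -- assemble the form gap of `T.toPMap ⊤`
    refine ⟨?_, ?_, hΩ0, ⟨Submodule.mem_top, ?_⟩, hΔ, ?_⟩
    · -- self-adjointness of the `LinearPMap`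
      rw [LinearPMap.isSelfAdjoint_def]
      have hd : Dense ((⊤ : Submodule 𝕜 E) : Set E) := by
        rw [Submodule.top_coe]
        exact dense_univ
      have := T.toPMap_adjoint_eq_adjoint_toPMap_of_dense hd
      rw [hT.adjoint_eq] at this
      exact this
    · exact hTpos.toLinearMap.isPositive_toPMap ⊤
    · simp [LinearMap.toPMap_apply, hΩ]
    · intro x hx
      simp only [LinearMap.toPMap_apply, coe_coe]
      rw [inner_re_symm]
      exact hK x hx

end Discharge

end ContinuousLinearMap
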